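import Summits.Langlands.Langlands.Theses.BrauerHeilbronnDescent

/-!
# Birth skeleton (BC3) — crux `CoherentPotentialAutomorphy` (stmt-Langlands-19253)
## route-Langlands-BrauerHeilbronnDescent · `Cruxes/CoherentPotentialAutomorphy/Lines/birth.lean`

The crux: given direction (A) over all number fields (the route's residual `AutToGalResidual`),
every irreducible geometric `ρ : Γ_F → GL_n(ℚ̄_ℓ)` admits a finite Galois `F'/F` such that over
EVERY intermediate `E` with `Gal(F'/E)` nilpotent, `ρ|Γ_E` is weakly isobaric-automorphic
(finitely many L-algebraic cuspidal `π_j` on `GL_{m_j}(𝔸_E)` whose Satake multisets at almost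
every place add up to the Frobenius characteristic polynomial of `ρ|Γ_E`; this `∃`-block is written
out verbatim below each time — the route's optional notion D2 `IsWeaklyIsobaricAutomorphic` is not
yet a tree definition, and a local `def … : Prop` would count as a vendored fact).

Line (the route's own two-layer plan "PA → ND", with ND cut into its automorphic step and its
Galois-theoretic induction):

* `stub_potentialWeakAutomorphy` (PA, the open core) — weak isobaric automorphy of `ρ` over SOME
  finite Galois `F'/F`;
* `stub_cyclicLayerDescent` (CD, Arthur–Clozel + (A)-realignment) — weak isobaric automorphy of
  `ρ|Γ_L` descends to `ρ|Γ_K` along one cyclic Galois layer `K → L` of number fields over `F`;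
* `stub_solvableTowerInduction` (NI, pure Galois theory) — a property of number fields over `F`
  that descends along cyclic layers descends from `F'` to any `E` with `Gal(F'/E)` solvable;
* `CoherentPotentialAutomorphy_of_stubs (hPA : PA) (hCD : CD) (hNI : NI) : <crux body verbatim>`
  (the assembly; real proof, no `sorry`) and
  `CoherentPotentialAutomorphy_of : CoherentPotentialAutomorphy` (by name, from the three stubs).

`sorry` occurs ONLY inside the three `stub_*` theorems. BC3 probes (each stub alone against the
crux and against the summit `Langlands`, battery `first | exact? | simpa | aesop`) all FAIL — see
the registrar's NOTES (planner-skel-stmt-Langlands-19253-0, 2026-08-17).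
-/

set_option linter.dupNamespace false

namespace Summit.Langlands.Langlands.Cruxes.CoherentPotentialAutomorphy.Birth

open scoped BigOperators NumberField
open Filter IsDedekindDomain NumberField
open Literature.NumberTheory.Automorphic Literature.NumberTheory.GaloisRepresentations
open Summit.Langlands Summit.Langlands.Langlands.Theses.BrauerHeilbronnDescent

/-- **Stub PA — potential weak (isobaric) automorphy.** Given direction (A) over all number
fields (the route's declared residual `AutToGalResidual`, as antecedent), every irreducible
geometric `ρ : Γ_F → GL_n(ℚ̄_ℓ)` becomes weakly isobaric-automorphic over SOME finite Galois
extension `F'/F`: finitely many L-algebraic cuspidal `π_j` on `GL_{m_j}(𝔸_{F'})`, `m_j ≥ 1`, whose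
Satake multisets at almost every place add up to the Frobenius characteristic polynomial of
`ρ|Γ_{F'}` (the case `E = F'` of the crux). This is where the crux's open content lives: known for
regular, potentially diagonalisable / polarisable-after-restriction `ρ` over CM or totally real `F`
(Barnet-Lamb–Gee–Geraghty–Taylor 2014, Thm. C; Harris–Shepherd-Barron–Taylor 2010), open for
irregular Hodge–Tate weights or general `F`. Strictly weaker than the crux (ONE field, not every
nilpotent-co subfield); no descent inside. [cite: BarnetlambEtAl2014, Thm. C] -/
theorem stub_potentialWeakAutomorphy :
    AutToGalResidual →
    ∀ (F : Type) [Field F] [NumberField F] (n : ℕ), 0 < n →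
    ∀ (ℓ : ℕ) [Fact ℓ.Prime] (ι : PadicAlgCl ℓ ≃+* ℂ) (R : ReciprocityData F)
      (ρ : FramedGaloisRep F (PadicAlgCl ℓ) n),
      ρ.toGaloisRep.IsIrreducible → IsGeometricFramed R ρ →
      ∃ (F' : Type) (_ : Field F') (_ : NumberField F') (_ : Algebra F F') (_ : IsGalois F F'),
        ∃ (k : ℕ) (m : Fin k → ℕ) (hc : ∀ j, isCompact_glFiniteIntegralLevel (m j) F')
          (π : ∀ j, CuspidalAutomorphicRepData (m j) F' (hc j)),
          (∀ j, 0 < m j) ∧ (∀ j, (π j).1.IsLAlgebraic) ∧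
            ∀ᶠ w : HeightOneSpectrum (𝓞 F') in cofinite, ∃ α : Fin k → Multiset ℂ,
              (∀ j, (π j).1.HasSatakeParamAt w (α j)) ∧ (ρ.restrictField F').IsUnramifiedAt w ∧
                (ρ.restrictField F').HasFrobCharpolyAt w (arithFrobPolyOfSatake ι w.residueCard 1 (∑ j, α j)) := by
  sorry

/-- **Stub CD — descent of weak isobaric automorphy along ONE cyclic Galois layer.** Given (A)
over all number fields, for an irreducible geometric `ρ` over `F` and number fields `F → K → L` with
`L/K` Galois and `Gal(L/K)` CYCLIC (the trivial layer `K ≅ L` included: transport of structure),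
weak isobaric automorphy of `ρ|Γ_L` descends to `ρ|Γ_K`. Mechanism (Arthur–Clozel, cyclic prime
degree, iterated inside a cyclic group): `ρ|Γ_K` is semisimple (Clifford, `ρ` irreducible over
`F`); by (A) over `L` and Chebotarev + Brauer–Nesbitt the cuspidal pieces over `L` realise the
irreducible constituents of `ρ|Γ_L`; a Galois-stable piece `Π` descends (`Π = BC(π₀)`, AC III
Thm. 4.2) and (A) over `K` realigns the twist (`σ ≅ ρ_{π₀} ⊗ χ`, `χ ∈ Gal(L/K)^`), a non-stable
orbit is automorphically induced (AC III Thm. 6.2, cuspidal since `π ≇ π^g`); L-algebraicity is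
read off at `∞`. Why it might fail as typed: composite cyclic degree needs the prime-step iteration
through intermediate fields (Lapid–Rogawski caveat on AC for non-prime degree), and the transport of
`CuspidalAutomorphicRepData` along a field isomorphism is not in the tree.
[cite: ArthurClozelAMS120, Ch. 3 Thm. 4.2, Thm. 6.2] -/
theorem stub_cyclicLayerDescent :
    AutToGalResidual →
    ∀ (F : Type) [Field F] [NumberField F] (n : ℕ), 0 < n →
    ∀ (ℓ : ℕ) [Fact ℓ.Prime] (ι : PadicAlgCl ℓ ≃+* ℂ) (R : ReciprocityData F)
      (ρ : FramedGaloisRep F (PadicAlgCl ℓ) n),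
      ρ.toGaloisRep.IsIrreducible → IsGeometricFramed R ρ →
      ∀ (K L : Type) [Field K] [NumberField K] [Algebra F K]
        [Field L] [NumberField L] [Algebra F L] [Algebra K L] [IsScalarTower F K L] [IsGalois K L],
        IsCyclic (L ≃ₐ[K] L) →
        (∃ (k : ℕ) (m : Fin k → ℕ) (hc : ∀ j, isCompact_glFiniteIntegralLevel (m j) L)
          (π : ∀ j, CuspidalAutomorphicRepData (m j) L (hc j)),
          (∀ j, 0 < m j) ∧ (∀ j, (π j).1.IsLAlgebraic) ∧
            ∀ᶠ w : HeightOneSpectrum (𝓞 L) in cofinite, ∃ α : Fin k → Multiset ℂ,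
              (∀ j, (π j).1.HasSatakeParamAt w (α j)) ∧ (ρ.restrictField L).IsUnramifiedAt w ∧
                (ρ.restrictField L).HasFrobCharpolyAt w (arithFrobPolyOfSatake ι w.residueCard 1 (∑ j, α j))) →
        ∃ (k : ℕ) (m : Fin k → ℕ) (hc : ∀ j, isCompact_glFiniteIntegralLevel (m j) K)
          (π : ∀ j, CuspidalAutomorphicRepData (m j) K (hc j)),
          (∀ j, 0 < m j) ∧ (∀ j, (π j).1.IsLAlgebraic) ∧
            ∀ᶠ w : HeightOneSpectrum (𝓞 K) in cofinite, ∃ α : Fin k → Multiset ℂ,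
              (∀ j, (π j).1.HasSatakeParamAt w (α j)) ∧ (ρ.restrictField K).IsUnramifiedAt w ∧
                (ρ.restrictField K).HasFrobCharpolyAt w (arithFrobPolyOfSatake ι w.residueCard 1 (∑ j, α j)) := by
  sorry

/-- **Stub NI — solvable towers are climbed down by cyclic layers (pure Galois theory).** For
ANY property `P` of number fields over `F` that descends along every cyclic Galois layer `K → L`
(over `F`, trivial layer included), `P` descends from `F'` to every subfield `E` over which `F'` is
Galois with SOLVABLE group (a fortiori nilpotent, which is all the crux needs): a composition series
`1 = G₀ ◁ G₁ ◁ ⋯ ◁ G_r = Gal(F'/E)` with cyclic factors gives, by the Galois correspondence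
(`IsGalois.intermediateFieldEquivSubgroup`), a chain of types `F', F'^{G₁}, …, F'^{G_{r-1}}, E`
whose consecutive layers are Galois with cyclic group; the trivial cyclic layer absorbs the
isomorphisms `E ≃ F'^{G_r}`, `F' ≃ F'^{G₀}` between distinct types. Genuine `M`-sized Lean work
(composition series of finite solvable groups with cyclic factors; instance plumbing for
`IntermediateField` layers), independent of automorphic forms. [folklore] -/
theorem stub_solvableTowerInduction :
    ∀ (F : Type) [Field F] [NumberField F]
      (P : ∀ (K : Type) [Field K] [NumberField K] [Algebra F K], Prop),
      (∀ (K L : Type) [Field K] [NumberField K] [Algebra F K]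
          [Field L] [NumberField L] [Algebra F L] [Algebra K L] [IsScalarTower F K L] [IsGalois K L],
          IsCyclic (L ≃ₐ[K] L) → P L → P K) →
      ∀ (F' : Type) [Field F'] [NumberField F'] [Algebra F F']
        (E : Type) [Field E] [NumberField E] [Algebra F E] [Algebra E F'] [IsScalarTower F E F']
        [IsGalois E F'], IsSolvable (F' ≃ₐ[E] F') → P F' → P E := by
  sorry

/-- **Assembly of the line** (kernel-checked, no `sorry`): PA gives the Galois extension `F'/F`;
for a subfield `E` with `Gal(F'/E)` nilpotent (hence solvable, `IsNilpotent.to_isSolvable`; `F'/E`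
is Galois by `IsGalois.tower_top_of_isGalois`), NI applied to the property "`ρ|Γ_K` is weakly
isobaric-automorphic", which descends along cyclic layers by CD, carries weak isobaric automorphy
from `F'` down to `E`. The conclusion is VERBATIM the body of the crux
`BrauerHeilbronnDescent.CoherentPotentialAutomorphy` (stmt-Langlands-19253), so that
`CoherentPotentialAutomorphy_of` below concludes the crux BY NAME with no hypotheses (registrar
shape: the skeleton audit admits only registered stubs / route items as hypotheses of the by-name
theorem). -/
theorem CoherentPotentialAutomorphy_of_stubs
    (hPA : AutToGalResidual →
    ∀ (F : Type) [Field F] [NumberField F] (n : ℕ), 0 < n →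
    ∀ (ℓ : ℕ) [Fact ℓ.Prime] (ι : PadicAlgCl ℓ ≃+* ℂ) (R : ReciprocityData F)
      (ρ : FramedGaloisRep F (PadicAlgCl ℓ) n),
      ρ.toGaloisRep.IsIrreducible → IsGeometricFramed R ρ →
      ∃ (F' : Type) (_ : Field F') (_ : NumberField F') (_ : Algebra F F') (_ : IsGalois F F'),
        ∃ (k : ℕ) (m : Fin k → ℕ) (hc : ∀ j, isCompact_glFiniteIntegralLevel (m j) F')
          (π : ∀ j, CuspidalAutomorphicRepData (m j) F' (hc j)),
          (∀ j, 0 < m j) ∧ (∀ j, (π j).1.IsLAlgebraic) ∧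
            ∀ᶠ w : HeightOneSpectrum (𝓞 F') in cofinite, ∃ α : Fin k → Multiset ℂ,
              (∀ j, (π j).1.HasSatakeParamAt w (α j)) ∧ (ρ.restrictField F').IsUnramifiedAt w ∧
                (ρ.restrictField F').HasFrobCharpolyAt w (arithFrobPolyOfSatake ι w.residueCard 1 (∑ j, α j)))
    (hCD : AutToGalResidual →
    ∀ (F : Type) [Field F] [NumberField F] (n : ℕ), 0 < n →
    ∀ (ℓ : ℕ) [Fact ℓ.Prime] (ι : PadicAlgCl ℓ ≃+* ℂ) (R : ReciprocityData F)
      (ρ : FramedGaloisRep F (PadicAlgCl ℓ) n),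
      ρ.toGaloisRep.IsIrreducible → IsGeometricFramed R ρ →
      ∀ (K L : Type) [Field K] [NumberField K] [Algebra F K]
        [Field L] [NumberField L] [Algebra F L] [Algebra K L] [IsScalarTower F K L] [IsGalois K L],
        IsCyclic (L ≃ₐ[K] L) →
        (∃ (k : ℕ) (m : Fin k → ℕ) (hc : ∀ j, isCompact_glFiniteIntegralLevel (m j) L)
          (π : ∀ j, CuspidalAutomorphicRepData (m j) L (hc j)),
          (∀ j, 0 < m j) ∧ (∀ j, (π j).1.IsLAlgebraic) ∧
            ∀ᶠ w : HeightOneSpectrum (𝓞 L) in cofinite, ∃ α : Fin k → Multiset ℂ,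
              (∀ j, (π j).1.HasSatakeParamAt w (α j)) ∧ (ρ.restrictField L).IsUnramifiedAt w ∧
                (ρ.restrictField L).HasFrobCharpolyAt w (arithFrobPolyOfSatake ι w.residueCard 1 (∑ j, α j))) →
        ∃ (k : ℕ) (m : Fin k → ℕ) (hc : ∀ j, isCompact_glFiniteIntegralLevel (m j) K)
          (π : ∀ j, CuspidalAutomorphicRepData (m j) K (hc j)),
          (∀ j, 0 < m j) ∧ (∀ j, (π j).1.IsLAlgebraic) ∧
            ∀ᶠ w : HeightOneSpectrum (𝓞 K) in cofinite, ∃ α : Fin k → Multiset ℂ,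
              (∀ j, (π j).1.HasSatakeParamAt w (α j)) ∧ (ρ.restrictField K).IsUnramifiedAt w ∧
                (ρ.restrictField K).HasFrobCharpolyAt w (arithFrobPolyOfSatake ι w.residueCard 1 (∑ j, α j)))
    (hNI : ∀ (F : Type) [Field F] [NumberField F]
      (P : ∀ (K : Type) [Field K] [NumberField K] [Algebra F K], Prop),
      (∀ (K L : Type) [Field K] [NumberField K] [Algebra F K]
          [Field L] [NumberField L] [Algebra F L] [Algebra K L] [IsScalarTower F K L] [IsGalois K L],
          IsCyclic (L ≃ₐ[K] L) → P L → P K) →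
      ∀ (F' : Type) [Field F'] [NumberField F'] [Algebra F F']
        (E : Type) [Field E] [NumberField E] [Algebra F E] [Algebra E F'] [IsScalarTower F E F']
        [IsGalois E F'], IsSolvable (F' ≃ₐ[E] F') → P F' → P E) :
    (∀ (E : Type) [Field E] [NumberField E] (RE : ReciprocityData E) (m : ℕ), 0 < m → ∀ hc :
      isCompact_glFiniteIntegralLevel m E, AutomorphicToGalois m RE hc) → ∀ (F : Type) [Field F]
      [NumberField F] (n : ℕ), 0 < n → ∀ (ℓ : ℕ) [Fact ℓ.Prime] (ι : PadicAlgCl ℓ ≃+* ℂ) (R :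
      ReciprocityData F) (ρ : FramedGaloisRep F (PadicAlgCl ℓ) n), ρ.toGaloisRep.IsIrreducible →
      IsGeometricFramed R ρ → ∃ (F' : Type) (_ : Field F') (_ : NumberField F') (_ : Algebra F
      F') (_ : IsGalois F F'), ∀ (E : Type) [Field E] [NumberField E] [Algebra F E] [Algebra E
      F'] [IsScalarTower F E F'], Group.IsNilpotent (F' ≃ₐ[E] F') → ∃ (k : ℕ) (m : Fin k → ℕ)
      (hc : ∀ j, isCompact_glFiniteIntegralLevel (m j) E) (π : ∀ j, CuspidalAutomorphicRepData
      (m j) E (hc j)), (∀ j, 0 < m j) ∧ (∀ j, (π j).1.IsLAlgebraic) ∧ ∀ᶠ w : HeightOneSpectrum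
      (RingOfIntegers E) in cofinite, ∃ α : Fin k → Multiset ℂ, (∀ j, (π j).1.HasSatakeParamAt w
      (α j)) ∧ (ρ.restrictField E).IsUnramifiedAt w ∧ (ρ.restrictField E).HasFrobCharpolyAt w
      (arithFrobPolyOfSatake ι w.residueCard 1 (∑ j, α j)) := by
  intro hA F _ _ n hn ℓ _ ι R ρ hirr hgeo
  obtain ⟨F', _, _, _, _, hF'⟩ := hPA hA F n hn ℓ ι R ρ hirr hgeo
  refine ⟨F', ‹_›, ‹_›, ‹_›, ‹_›, ?_⟩
  intro E _ _ _ _ _ hnil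
  haveI : IsGalois E F' := IsGalois.tower_top_of_isGalois F E F'
  haveI : IsSolvable (F' ≃ₐ[E] F') := by haveI := hnil; infer_instance
  exact hNI F (fun (K : Type) [Field K] [NumberField K] [Algebra F K] =>
      ∃ (k : ℕ) (m : Fin k → ℕ) (hc : ∀ j, isCompact_glFiniteIntegralLevel (m j) K)
        (π : ∀ j, CuspidalAutomorphicRepData (m j) K (hc j)),
        (∀ j, 0 < m j) ∧ (∀ j, (π j).1.IsLAlgebraic) ∧
          ∀ᶠ w : HeightOneSpectrum (𝓞 K) in cofinite, ∃ α : Fin k → Multiset ℂ,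
            (∀ j, (π j).1.HasSatakeParamAt w (α j)) ∧ (ρ.restrictField K).IsUnramifiedAt w ∧
              (ρ.restrictField K).HasFrobCharpolyAt w (arithFrobPolyOfSatake ι w.residueCard 1 (∑ j, α j)))
    (fun K L _ _ _ _ _ _ _ _ _ hcyc hL => hCD hA F n hn ℓ ι R ρ hirr hgeo K L hcyc hL)
    F' E ‹_› hF'

/-- **The line concludes the crux by name**: `CoherentPotentialAutomorphy` (stmt-Langlands-19253) of
route-Langlands-BrauerHeilbronnDescent follows from the three stubs via
`CoherentPotentialAutomorphy_of_stubs`. This declaration contains no `sorry` of its own; it is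
closed exactly when the three `stub_*` theorems are. -/
theorem CoherentPotentialAutomorphy_of : CoherentPotentialAutomorphy :=
  CoherentPotentialAutomorphy_of_stubs
    stub_potentialWeakAutomorphy stub_cyclicLayerDescent stub_solvableTowerInduction

end Summit.Langlands.Langlands.Cruxes.CoherentPotentialAutomorphy.Birth
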